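import Summits.BirchSwinnertonDyer.BirchSwinnertonDyer.Theorems.Rank1ResidualJetCarrierMultKitOrder
import Summits.BirchSwinnertonDyer.BirchSwinnertonDyer.Theorems.Rank1ResidualJetCarrierAddKit
import HarnessLib

/-!
# T1 JET (cell `bsd-jet`), bucket B of `JET@p∣N`: by-name SAMPLE ROWS for the forthcoming
# OFFER-JET-DOCSTRIKE-BUCKET-B (director-bsd 2026-08-27T02:36:54Z «pre-stage»; referee C R416 grammar) —
# file 2 of 3: B-mult at p = 3 (split I_n), roads O and R, 8 cells

HONEST FRAMING (programme file §HONESTY, verbatim): «no tranche here proves BSD; ARM L moves the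
LITERAL column of an r ≤ 1 census into the kernel-proved-modulo-named-print column.» THEOREMS ONLY
(seat `bsd-jet-pv-2`, session g2; `--supports stmt-BirchSwinnertonDyer-14418`, helper). Each record is
`BSDp W p` for one census cell of `HOME/census-jet/jet_keys_B_classes.tsv` 4c8599cf93bc5459 through the
landed kits (`Rank1ResidualJetCarrierMultKit.lean` p465088, `…MultKitOrder.lean` p474328,
`…CarrierAddKit.lean` p475627), with every numeric hypothesis (`Δ ≠ 0`, the support-form Kraus
certificate, reduction type at `p`, the image witnesses) re-verified by `decide`/`norm_num` in the
kernel from the kit witness tables `HOME/sheets/pv2-B3-witness/` (j262920) and `pv2-B5-witness/`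
(j263826); the READING binder (`JET.JetchevDivisibilityCarrierMult` = K3 or `…CarrierAdd` = K4,
referee C R385/R416: GAPPED-in-print, gap closed BY NAME), the published binders, the Heegner datum,
the index line at the carrier and `#Ш_an` stay DISPLAYED. The stratified sample (road × p × Kodaira
type × rank) is the bucket-B analogue of the 55-row DOCSTRIKE-A sample (ty, JetDocstrikeARecords01–07).
CONDITIONAL; nothing is booked by this file; 0 classes move.
References: [Jetchev2008] Cor. 1.5; [Cremona2006] Table 1; [Serre1972] §2.4 Prop. 15, §2.8 Prop. 19;
[Kraus1989] Prop. 1–2; [Wuthrich2014] Lemma 20; [Elkies2006] (mod-9 tower witness).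
-/

set_option autoImplicit false

noncomputable section

open scoped Classical

open WeierstrassCurve Literature.NumberTheory.EllipticCurves
  Literature.NumberTheory.EllipticCurves.ModularForms
  Literature.NumberTheory.EllipticCurves.Rank1Residual
  Literature.NumberTheory.EllipticCurves.Rank1Residual.X11RankOneCertificates
  Summit.BirchSwinnertonDyer.BirchSwinnertonDyer.Rank1Residual
  Summit.BirchSwinnertonDyer.BirchSwinnertonDyer.Rank1Residual.IntModel
  Summit.BirchSwinnertonDyer.BirchSwinnertonDyer.Rank1Residual.X11RankOne
  Summit.BirchSwinnertonDyer.Rank1Residual Summit.BirchSwinnertonDyer.Rank1Residual.X11b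

namespace Summit.BirchSwinnertonDyer.Rank1Residual.JET

/-- **`BSD(E,3)` for `23232dh1`, bucket B-mult, road O** (`N = 23232`, `r = 1`, split `I3` at `3`,
`c₃ = 3`, `D = -95`; model `[0,1,0,-337,1967]`, `Δ = 588791808`, support `2:14;3:3;11:3`; no (ram) prime exists — road O is the by-name road): kit
`JET.bsdp_of_jetRowCarrierMult_of_irr_of_order` with Frobenius witnesses irr `(5, 4)`, order-3 `(7, 6)`
(kit table `HOME/sheets/pv2-B3-witness/witness_B_p3.tsv`, job j262920). Displayed binders: `hJ` (READING K3), the published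
`hMcU` … `hlev`, the Heegner datum and the index line at the carrier `3`. CONDITIONAL; nothing booked.
[cite: Jetchev2008, Cor. 1.5 (p. 812)] [cite: Cremona2006, Table 1 (label 23232dh1)] -/
theorem bsdp_jetBmult_23232dh1_3_order
    (hJ : JetchevDivisibilityCarrierMult)
    (hMcU : McCallum1991_padicValNat_card_sha_primary_add_le_of_globalDivisibility)
    (hGZK : rank_eq_analyticRank_of_analyticRank_le_one)
    (hKo : ∀ (N : ℕ) [NeZero N] (W : WeierstrassCurve ℚ) (K : Type) [Field K] [NumberField K],
      kolyvagin N W K)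
    (hrec : ∀ (N : ℕ) [NeZero N] (W : WeierstrassCurve ℚ) (K : Type) [Field K] [NumberField K],
      heegnerPointOfConductor_one_galoisConj N W K)
    (hD36 : ∀ (N : ℕ) [NeZero N] (W : WeierstrassCurve ℚ) (K : Type) [Field K] [NumberField K],
      phi_heegnerTau_mem_singularModuliField N W K)
    (hlev : ∀ {N : ℕ} [NeZero N], IsNewformOf.level_eq_conductorNorm (N := N))
    (W : WeierstrassCurve ℚ) (hW : W = ⟨0, 1, 0, (-337), 1967⟩)
    {N : ℕ} [NeZero N] {K : Type} [Field K] [NumberField K] (hK : IsImaginaryQuadratic K)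
    (hD3 : NumberField.discr K ≠ -3) (hD4 : NumberField.discr K ≠ -4)
    (hH : SatisfiesHeegnerHypothesis N K) {P : (W.baseChange K).toAffine.Point}
    (hP : IsHeegnerPoint N W K P) (hnt : ¬ IsOfFinAddOrder P)
    (hI : padicValNat 3 (AddSubgroup.zmultiples P).index ≤
      padicValNat 3 ((W.baseChange ℚ_[3]).localTamagawaNumber ℤ_[3]))
    (hr : W.analyticRank ≤ 1) {s : ℚ} (hs : shaAn W = (s : ℂ)) (hv : padicValRat 3 s = 0) :
    BSDp W 3 :=
  bsdp_of_jetRowCarrierMult_of_irr_of_order 3 Nat.prime_three (by norm_num) 0 1 0 (-337) 1967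
    (by decide +kernel) [(2, 6, 14), (3, 1, 3), (11, 2, 3)]
    (by intro t ht; simp only [List.mem_cons, List.not_mem_nil, or_false] at ht
        rcases ht with rfl | rfl | rfl <;> norm_num)
    (by decide +kernel) (by decide +kernel) (by decide +kernel) (by decide +kernel)
    5 7 (by norm_num) (by norm_num) (by norm_num) (by norm_num) (by norm_num) (by norm_num)
    (by decide +kernel) (by decide +kernel) (n₁ := 4) (n₂ := 6) (by decide +kernel)
    (by decide +kernel) (by decide) (by decide) hJ hMcU hGZK hKo hrec hD36 hlev W hW hK hD3 hD4 hH hP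
    hnt hI hr hs hv

/-- **`BSD(E,3)` for `25392p1`, bucket B-mult, road O** (`N = 25392`, `r = 1`, split `I3` at `3`,
`c₃ = 3`, `D = -191`; model `[0,1,0,-199,-1144]`, `Δ = 5256144`, support `2:4;3:3;23:3`; no (ram) prime exists — road O is the by-name road): kit
`JET.bsdp_of_jetRowCarrierMult_of_irr_of_order` with Frobenius witnesses irr `(5, 8)`, order-3 `(7, 6)`
(kit table `HOME/sheets/pv2-B3-witness/witness_B_p3.tsv`, job j262920). Displayed binders: `hJ` (READING K3), the published
`hMcU` … `hlev`, the Heegner datum and the index line at the carrier `3`. CONDITIONAL; nothing booked.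
[cite: Jetchev2008, Cor. 1.5 (p. 812)] [cite: Cremona2006, Table 1 (label 25392p1)] -/
theorem bsdp_jetBmult_25392p1_3_order
    (hJ : JetchevDivisibilityCarrierMult)
    (hMcU : McCallum1991_padicValNat_card_sha_primary_add_le_of_globalDivisibility)
    (hGZK : rank_eq_analyticRank_of_analyticRank_le_one)
    (hKo : ∀ (N : ℕ) [NeZero N] (W : WeierstrassCurve ℚ) (K : Type) [Field K] [NumberField K],
      kolyvagin N W K)
    (hrec : ∀ (N : ℕ) [NeZero N] (W : WeierstrassCurve ℚ) (K : Type) [Field K] [NumberField K],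
      heegnerPointOfConductor_one_galoisConj N W K)
    (hD36 : ∀ (N : ℕ) [NeZero N] (W : WeierstrassCurve ℚ) (K : Type) [Field K] [NumberField K],
      phi_heegnerTau_mem_singularModuliField N W K)
    (hlev : ∀ {N : ℕ} [NeZero N], IsNewformOf.level_eq_conductorNorm (N := N))
    (W : WeierstrassCurve ℚ) (hW : W = ⟨0, 1, 0, (-199), (-1144)⟩)
    {N : ℕ} [NeZero N] {K : Type} [Field K] [NumberField K] (hK : IsImaginaryQuadratic K)
    (hD3 : NumberField.discr K ≠ -3) (hD4 : NumberField.discr K ≠ -4)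
    (hH : SatisfiesHeegnerHypothesis N K) {P : (W.baseChange K).toAffine.Point}
    (hP : IsHeegnerPoint N W K P) (hnt : ¬ IsOfFinAddOrder P)
    (hI : padicValNat 3 (AddSubgroup.zmultiples P).index ≤
      padicValNat 3 ((W.baseChange ℚ_[3]).localTamagawaNumber ℤ_[3]))
    (hr : W.analyticRank ≤ 1) {s : ℚ} (hs : shaAn W = (s : ℂ)) (hv : padicValRat 3 s = 0) :
    BSDp W 3 :=
  bsdp_of_jetRowCarrierMult_of_irr_of_order 3 Nat.prime_three (by norm_num) 0 1 0 (-199) (-1144)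
    (by decide +kernel) [(2, 4, 4), (3, 1, 3), (23, 2, 3)]
    (by intro t ht; simp only [List.mem_cons, List.not_mem_nil, or_false] at ht
        rcases ht with rfl | rfl | rfl <;> norm_num)
    (by decide +kernel) (by decide +kernel) (by decide +kernel) (by decide +kernel)
    5 7 (by norm_num) (by norm_num) (by norm_num) (by norm_num) (by norm_num) (by norm_num)
    (by decide +kernel) (by decide +kernel) (n₁ := 8) (n₂ := 6) (by decide +kernel)
    (by decide +kernel) (by decide) (by decide) hJ hMcU hGZK hKo hrec hD36 hlev W hW hK hD3 hD4 hH hP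
    hnt hI hr hs hv

/-- **`BSD(E,3)` for `312f1`, bucket B-mult, road O** (`N = 312`, `r = 1`, split `I3` at `3`,
`c₃ = 3`, `D = -23`; model `[0,1,0,5,14]`, `Δ = -73008`, support `2:4;3:3;13:2`; (ram) prime 13 also available): kit
`JET.bsdp_of_jetRowCarrierMult_of_irr_of_order` with Frobenius witnesses irr `(5, 10)`, order-3 `(7, 12)`
(kit table `HOME/sheets/pv2-B3-witness/witness_B_p3.tsv`, job j262920). Displayed binders: `hJ` (READING K3), the published
`hMcU` … `hlev`, the Heegner datum and the index line at the carrier `3`. CONDITIONAL; nothing booked.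
[cite: Jetchev2008, Cor. 1.5 (p. 812)] [cite: Cremona2006, Table 1 (label 312f1)] -/
theorem bsdp_jetBmult_312f1_3_order
    (hJ : JetchevDivisibilityCarrierMult)
    (hMcU : McCallum1991_padicValNat_card_sha_primary_add_le_of_globalDivisibility)
    (hGZK : rank_eq_analyticRank_of_analyticRank_le_one)
    (hKo : ∀ (N : ℕ) [NeZero N] (W : WeierstrassCurve ℚ) (K : Type) [Field K] [NumberField K],
      kolyvagin N W K)
    (hrec : ∀ (N : ℕ) [NeZero N] (W : WeierstrassCurve ℚ) (K : Type) [Field K] [NumberField K],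
      heegnerPointOfConductor_one_galoisConj N W K)
    (hD36 : ∀ (N : ℕ) [NeZero N] (W : WeierstrassCurve ℚ) (K : Type) [Field K] [NumberField K],
      phi_heegnerTau_mem_singularModuliField N W K)
    (hlev : ∀ {N : ℕ} [NeZero N], IsNewformOf.level_eq_conductorNorm (N := N))
    (W : WeierstrassCurve ℚ) (hW : W = ⟨0, 1, 0, 5, 14⟩)
    {N : ℕ} [NeZero N] {K : Type} [Field K] [NumberField K] (hK : IsImaginaryQuadratic K)
    (hD3 : NumberField.discr K ≠ -3) (hD4 : NumberField.discr K ≠ -4)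
    (hH : SatisfiesHeegnerHypothesis N K) {P : (W.baseChange K).toAffine.Point}
    (hP : IsHeegnerPoint N W K P) (hnt : ¬ IsOfFinAddOrder P)
    (hI : padicValNat 3 (AddSubgroup.zmultiples P).index ≤
      padicValNat 3 ((W.baseChange ℚ_[3]).localTamagawaNumber ℤ_[3]))
    (hr : W.analyticRank ≤ 1) {s : ℚ} (hs : shaAn W = (s : ℂ)) (hv : padicValRat 3 s = 0) :
    BSDp W 3 :=
  bsdp_of_jetRowCarrierMult_of_irr_of_order 3 Nat.prime_three (by norm_num) 0 1 0 5 14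
    (by decide +kernel) [(2, 3, 4), (3, 1, 3), (13, 1, 2)]
    (by intro t ht; simp only [List.mem_cons, List.not_mem_nil, or_false] at ht
        rcases ht with rfl | rfl | rfl <;> norm_num)
    (by decide +kernel) (by decide +kernel) (by decide +kernel) (by decide +kernel)
    5 7 (by norm_num) (by norm_num) (by norm_num) (by norm_num) (by norm_num) (by norm_num)
    (by decide +kernel) (by decide +kernel) (n₁ := 10) (n₂ := 12) (by decide +kernel)
    (by decide +kernel) (by decide) (by decide) hJ hMcU hGZK hKo hrec hD36 hlev W hW hK hD3 hD4 hH hP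
    hnt hI hr hs hv

/-- **`BSD(E,3)` for `1329a1`, bucket B-mult, road O** (`N = 1329`, `r = 1`, split `I3` at `3`,
`c₃ = 3`, `D = -8`; model `[1,0,1,2,5]`, `Δ = -11961`, support `3:3;443:1`; (ram) prime 443 also available): kit
`JET.bsdp_of_jetRowCarrierMult_of_irr_of_order` with Frobenius witnesses irr `(5, 5)`, order-3 `(7, 12)`
(kit table `HOME/sheets/pv2-B3-witness/witness_B_p3.tsv`, job j262920). Displayed binders: `hJ` (READING K3), the published
`hMcU` … `hlev`, the Heegner datum and the index line at the carrier `3`. CONDITIONAL; nothing booked.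
[cite: Jetchev2008, Cor. 1.5 (p. 812)] [cite: Cremona2006, Table 1 (label 1329a1)] -/
theorem bsdp_jetBmult_1329a1_3_order
    (hJ : JetchevDivisibilityCarrierMult)
    (hMcU : McCallum1991_padicValNat_card_sha_primary_add_le_of_globalDivisibility)
    (hGZK : rank_eq_analyticRank_of_analyticRank_le_one)
    (hKo : ∀ (N : ℕ) [NeZero N] (W : WeierstrassCurve ℚ) (K : Type) [Field K] [NumberField K],
      kolyvagin N W K)
    (hrec : ∀ (N : ℕ) [NeZero N] (W : WeierstrassCurve ℚ) (K : Type) [Field K] [NumberField K],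
      heegnerPointOfConductor_one_galoisConj N W K)
    (hD36 : ∀ (N : ℕ) [NeZero N] (W : WeierstrassCurve ℚ) (K : Type) [Field K] [NumberField K],
      phi_heegnerTau_mem_singularModuliField N W K)
    (hlev : ∀ {N : ℕ} [NeZero N], IsNewformOf.level_eq_conductorNorm (N := N))
    (W : WeierstrassCurve ℚ) (hW : W = ⟨1, 0, 1, 2, 5⟩)
    {N : ℕ} [NeZero N] {K : Type} [Field K] [NumberField K] (hK : IsImaginaryQuadratic K)
    (hD3 : NumberField.discr K ≠ -3) (hD4 : NumberField.discr K ≠ -4)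
    (hH : SatisfiesHeegnerHypothesis N K) {P : (W.baseChange K).toAffine.Point}
    (hP : IsHeegnerPoint N W K P) (hnt : ¬ IsOfFinAddOrder P)
    (hI : padicValNat 3 (AddSubgroup.zmultiples P).index ≤
      padicValNat 3 ((W.baseChange ℚ_[3]).localTamagawaNumber ℤ_[3]))
    (hr : W.analyticRank ≤ 1) {s : ℚ} (hs : shaAn W = (s : ℂ)) (hv : padicValRat 3 s = 0) :
    BSDp W 3 :=
  bsdp_of_jetRowCarrierMult_of_irr_of_order 3 Nat.prime_three (by norm_num) 1 0 1 2 5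
    (by decide +kernel) [(3, 1, 3), (443, 1, 1)]
    (by intro t ht; simp only [List.mem_cons, List.not_mem_nil, or_false] at ht
        rcases ht with rfl | rfl <;> norm_num)
    (by decide +kernel) (by decide +kernel) (by decide +kernel) (by decide +kernel)
    5 7 (by norm_num) (by norm_num) (by norm_num) (by norm_num) (by norm_num) (by norm_num)
    (by decide +kernel) (by decide +kernel) (n₁ := 5) (n₂ := 12) (by decide +kernel)
    (by decide +kernel) (by decide) (by decide) hJ hMcU hGZK hKo hrec hD36 hlev W hW hK hD3 hD4 hH hP
    hnt hI hr hs hv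

/-- **`BSD(E,3)` for `1506e1`, bucket B-mult, road O** (`N = 1506`, `r = 1`, split `I3` at `3`,
`c₃ = 3`, `D = -47`; model `[1,0,0,-16,32]`, `Δ = -216864`, support `2:5;3:3;251:1`; (ram) prime 2 also available): kit
`JET.bsdp_of_jetRowCarrierMult_of_irr_of_order` with Frobenius witnesses irr `(5, 7)`, order-3 `(7, 12)`
(kit table `HOME/sheets/pv2-B3-witness/witness_B_p3.tsv`, job j262920). Displayed binders: `hJ` (READING K3), the published
`hMcU` … `hlev`, the Heegner datum and the index line at the carrier `3`. CONDITIONAL; nothing booked.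
[cite: Jetchev2008, Cor. 1.5 (p. 812)] [cite: Cremona2006, Table 1 (label 1506e1)] -/
theorem bsdp_jetBmult_1506e1_3_order
    (hJ : JetchevDivisibilityCarrierMult)
    (hMcU : McCallum1991_padicValNat_card_sha_primary_add_le_of_globalDivisibility)
    (hGZK : rank_eq_analyticRank_of_analyticRank_le_one)
    (hKo : ∀ (N : ℕ) [NeZero N] (W : WeierstrassCurve ℚ) (K : Type) [Field K] [NumberField K],
      kolyvagin N W K)
    (hrec : ∀ (N : ℕ) [NeZero N] (W : WeierstrassCurve ℚ) (K : Type) [Field K] [NumberField K],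
      heegnerPointOfConductor_one_galoisConj N W K)
    (hD36 : ∀ (N : ℕ) [NeZero N] (W : WeierstrassCurve ℚ) (K : Type) [Field K] [NumberField K],
      phi_heegnerTau_mem_singularModuliField N W K)
    (hlev : ∀ {N : ℕ} [NeZero N], IsNewformOf.level_eq_conductorNorm (N := N))
    (W : WeierstrassCurve ℚ) (hW : W = ⟨1, 0, 0, (-16), 32⟩)
    {N : ℕ} [NeZero N] {K : Type} [Field K] [NumberField K] (hK : IsImaginaryQuadratic K)
    (hD3 : NumberField.discr K ≠ -3) (hD4 : NumberField.discr K ≠ -4)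
    (hH : SatisfiesHeegnerHypothesis N K) {P : (W.baseChange K).toAffine.Point}
    (hP : IsHeegnerPoint N W K P) (hnt : ¬ IsOfFinAddOrder P)
    (hI : padicValNat 3 (AddSubgroup.zmultiples P).index ≤
      padicValNat 3 ((W.baseChange ℚ_[3]).localTamagawaNumber ℤ_[3]))
    (hr : W.analyticRank ≤ 1) {s : ℚ} (hs : shaAn W = (s : ℂ)) (hv : padicValRat 3 s = 0) :
    BSDp W 3 :=
  bsdp_of_jetRowCarrierMult_of_irr_of_order 3 Nat.prime_three (by norm_num) 1 0 0 (-16) 32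
    (by decide +kernel) [(2, 1, 5), (3, 1, 3), (251, 1, 1)]
    (by intro t ht; simp only [List.mem_cons, List.not_mem_nil, or_false] at ht
        rcases ht with rfl | rfl | rfl <;> norm_num)
    (by decide +kernel) (by decide +kernel) (by decide +kernel) (by decide +kernel)
    5 7 (by norm_num) (by norm_num) (by norm_num) (by norm_num) (by norm_num) (by norm_num)
    (by decide +kernel) (by decide +kernel) (n₁ := 7) (n₂ := 12) (by decide +kernel)
    (by decide +kernel) (by decide) (by decide) hJ hMcU hGZK hKo hrec hD36 hlev W hW hK hD3 hD4 hH hP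
    hnt hI hr hs hv

/-- **`BSD(E,3)` for `339a1`, bucket B-mult, road R** (`N = 339`, `r = 1`, split `I9` at `3`,
`c_3 = 9`, `D = -8`; model `[0,1,1,-441,3422]`, `Δ = -2224179`, support `3:9;113:1`): kit
`JET.bsdp_of_jetRowCarrierMult_of_ram` with the Frobenius witness irr `(5, 7)` and the (ram) witness
`m = 113`, `113^1 ∥ Δ`, `3 ∤ 1` (kit table `HOME/sheets/pv2-B3-witness/witness_B_p3.tsv`, job j262920). Displayed binders: `hJ` (READING K3), the
published `hMcU` … `hlev`, the Heegner datum and the index line at the carrier `3`. CONDITIONAL; nothing booked.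
[cite: Jetchev2008, Cor. 1.5 (p. 812)] [cite: Cremona2006, Table 1 (label 339a1)] -/
theorem bsdp_jetBmult_339a1_3_ram
    (hJ : JetchevDivisibilityCarrierMult)
    (hMcU : McCallum1991_padicValNat_card_sha_primary_add_le_of_globalDivisibility)
    (hGZK : rank_eq_analyticRank_of_analyticRank_le_one)
    (hKo : ∀ (N : ℕ) [NeZero N] (W : WeierstrassCurve ℚ) (K : Type) [Field K] [NumberField K],
      kolyvagin N W K)
    (hrec : ∀ (N : ℕ) [NeZero N] (W : WeierstrassCurve ℚ) (K : Type) [Field K] [NumberField K],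
      heegnerPointOfConductor_one_galoisConj N W K)
    (hD36 : ∀ (N : ℕ) [NeZero N] (W : WeierstrassCurve ℚ) (K : Type) [Field K] [NumberField K],
      phi_heegnerTau_mem_singularModuliField N W K)
    (hlev : ∀ {N : ℕ} [NeZero N], IsNewformOf.level_eq_conductorNorm (N := N))
    (W : WeierstrassCurve ℚ) (hW : W = ⟨0, 1, 1, (-441), 3422⟩)
    {N : ℕ} [NeZero N] {K : Type} [Field K] [NumberField K] (hK : IsImaginaryQuadratic K)
    (hD3 : NumberField.discr K ≠ -3) (hD4 : NumberField.discr K ≠ -4)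
    (hH : SatisfiesHeegnerHypothesis N K) {P : (W.baseChange K).toAffine.Point}
    (hP : IsHeegnerPoint N W K P) (hnt : ¬ IsOfFinAddOrder P)
    (hI : padicValNat 3 (AddSubgroup.zmultiples P).index ≤
      padicValNat 3 ((W.baseChange ℚ_[3]).localTamagawaNumber ℤ_[3]))
    (hr : W.analyticRank ≤ 1) {s : ℚ} (hs : shaAn W = (s : ℂ)) (hv : padicValRat 3 s = 0) :
    BSDp W 3 :=
  bsdp_of_jetRowCarrierMult_of_ram 3 Nat.prime_three (by norm_num) 0 1 1 (-441) 3422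
    (by decide +kernel) [(3, 1, 9), (113, 1, 1)]
    (by intro t ht; simp only [List.mem_cons, List.not_mem_nil, or_false] at ht
        rcases ht with rfl | rfl <;> norm_num)
    (by decide +kernel) (by decide +kernel) (by decide +kernel) (by decide +kernel)
    5 (by norm_num) (by norm_num) (by norm_num) (by decide +kernel) (n := 7) (by decide +kernel)
    (by decide) 113 (by norm_num) (by norm_num) (by decide +kernel) (by decide +kernel) (e := 1)
    (by decide +kernel) (by decide +kernel) (by norm_num) hJ hMcU hGZK hKo hrec hD36 hlev W hW hK hD3
    hD4 hH hP hnt hI hr hs hv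

/-- **`BSD(E,3)` for `528h1`, bucket B-mult, road R** (`N = 528`, `r = 1`, split `I3` at `3`,
`c_3 = 3`, `D = -95`; model `[0,1,0,-104,372]`, `Δ = 1216512`, support `2:12;3:3;11:1`): kit
`JET.bsdp_of_jetRowCarrierMult_of_ram` with the Frobenius witness irr `(5, 8)` and the (ram) witness
`m = 11`, `11^1 ∥ Δ`, `3 ∤ 1` (kit table `HOME/sheets/pv2-B3-witness/witness_B_p3.tsv`, job j262920). Displayed binders: `hJ` (READING K3), the
published `hMcU` … `hlev`, the Heegner datum and the index line at the carrier `3`. CONDITIONAL; nothing booked.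
[cite: Jetchev2008, Cor. 1.5 (p. 812)] [cite: Cremona2006, Table 1 (label 528h1)] -/
theorem bsdp_jetBmult_528h1_3_ram
    (hJ : JetchevDivisibilityCarrierMult)
    (hMcU : McCallum1991_padicValNat_card_sha_primary_add_le_of_globalDivisibility)
    (hGZK : rank_eq_analyticRank_of_analyticRank_le_one)
    (hKo : ∀ (N : ℕ) [NeZero N] (W : WeierstrassCurve ℚ) (K : Type) [Field K] [NumberField K],
      kolyvagin N W K)
    (hrec : ∀ (N : ℕ) [NeZero N] (W : WeierstrassCurve ℚ) (K : Type) [Field K] [NumberField K],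
      heegnerPointOfConductor_one_galoisConj N W K)
    (hD36 : ∀ (N : ℕ) [NeZero N] (W : WeierstrassCurve ℚ) (K : Type) [Field K] [NumberField K],
      phi_heegnerTau_mem_singularModuliField N W K)
    (hlev : ∀ {N : ℕ} [NeZero N], IsNewformOf.level_eq_conductorNorm (N := N))
    (W : WeierstrassCurve ℚ) (hW : W = ⟨0, 1, 0, (-104), 372⟩)
    {N : ℕ} [NeZero N] {K : Type} [Field K] [NumberField K] (hK : IsImaginaryQuadratic K)
    (hD3 : NumberField.discr K ≠ -3) (hD4 : NumberField.discr K ≠ -4)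
    (hH : SatisfiesHeegnerHypothesis N K) {P : (W.baseChange K).toAffine.Point}
    (hP : IsHeegnerPoint N W K P) (hnt : ¬ IsOfFinAddOrder P)
    (hI : padicValNat 3 (AddSubgroup.zmultiples P).index ≤
      padicValNat 3 ((W.baseChange ℚ_[3]).localTamagawaNumber ℤ_[3]))
    (hr : W.analyticRank ≤ 1) {s : ℚ} (hs : shaAn W = (s : ℂ)) (hv : padicValRat 3 s = 0) :
    BSDp W 3 :=
  bsdp_of_jetRowCarrierMult_of_ram 3 Nat.prime_three (by norm_num) 0 1 0 (-104) 372
    (by decide +kernel) [(2, 4, 12), (3, 1, 3), (11, 1, 1)]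
    (by intro t ht; simp only [List.mem_cons, List.not_mem_nil, or_false] at ht
        rcases ht with rfl | rfl | rfl <;> norm_num)
    (by decide +kernel) (by decide +kernel) (by decide +kernel) (by decide +kernel)
    5 (by norm_num) (by norm_num) (by norm_num) (by decide +kernel) (n := 8) (by decide +kernel)
    (by decide) 11 (by norm_num) (by norm_num) (by decide +kernel) (by decide +kernel) (e := 1)
    (by decide +kernel) (by decide +kernel) (by norm_num) hJ hMcU hGZK hKo hrec hD36 hlev W hW hK hD3
    hD4 hH hP hnt hI hr hs hv

/-- **`BSD(E,3)` for `573c1`, bucket B-mult, road R** (`N = 573`, `r = 1`, split `I3` at `3`,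
`c_3 = 3`, `D = -11`; model `[0,1,1,-4,-2]`, `Δ = 5157`, support `3:3;191:1`): kit
`JET.bsdp_of_jetRowCarrierMult_of_ram` with the Frobenius witness irr `(5, 8)` and the (ram) witness
`m = 191`, `191^1 ∥ Δ`, `3 ∤ 1` (kit table `HOME/sheets/pv2-B3-witness/witness_B_p3.tsv`, job j262920). Displayed binders: `hJ` (READING K3), the
published `hMcU` … `hlev`, the Heegner datum and the index line at the carrier `3`. CONDITIONAL; nothing booked.
[cite: Jetchev2008, Cor. 1.5 (p. 812)] [cite: Cremona2006, Table 1 (label 573c1)] -/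
theorem bsdp_jetBmult_573c1_3_ram
    (hJ : JetchevDivisibilityCarrierMult)
    (hMcU : McCallum1991_padicValNat_card_sha_primary_add_le_of_globalDivisibility)
    (hGZK : rank_eq_analyticRank_of_analyticRank_le_one)
    (hKo : ∀ (N : ℕ) [NeZero N] (W : WeierstrassCurve ℚ) (K : Type) [Field K] [NumberField K],
      kolyvagin N W K)
    (hrec : ∀ (N : ℕ) [NeZero N] (W : WeierstrassCurve ℚ) (K : Type) [Field K] [NumberField K],
      heegnerPointOfConductor_one_galoisConj N W K)
    (hD36 : ∀ (N : ℕ) [NeZero N] (W : WeierstrassCurve ℚ) (K : Type) [Field K] [NumberField K],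
      phi_heegnerTau_mem_singularModuliField N W K)
    (hlev : ∀ {N : ℕ} [NeZero N], IsNewformOf.level_eq_conductorNorm (N := N))
    (W : WeierstrassCurve ℚ) (hW : W = ⟨0, 1, 1, (-4), (-2)⟩)
    {N : ℕ} [NeZero N] {K : Type} [Field K] [NumberField K] (hK : IsImaginaryQuadratic K)
    (hD3 : NumberField.discr K ≠ -3) (hD4 : NumberField.discr K ≠ -4)
    (hH : SatisfiesHeegnerHypothesis N K) {P : (W.baseChange K).toAffine.Point}
    (hP : IsHeegnerPoint N W K P) (hnt : ¬ IsOfFinAddOrder P)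
    (hI : padicValNat 3 (AddSubgroup.zmultiples P).index ≤
      padicValNat 3 ((W.baseChange ℚ_[3]).localTamagawaNumber ℤ_[3]))
    (hr : W.analyticRank ≤ 1) {s : ℚ} (hs : shaAn W = (s : ℂ)) (hv : padicValRat 3 s = 0) :
    BSDp W 3 :=
  bsdp_of_jetRowCarrierMult_of_ram 3 Nat.prime_three (by norm_num) 0 1 1 (-4) (-2)
    (by decide +kernel) [(3, 1, 3), (191, 1, 1)]
    (by intro t ht; simp only [List.mem_cons, List.not_mem_nil, or_false] at ht
        rcases ht with rfl | rfl <;> norm_num)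
    (by decide +kernel) (by decide +kernel) (by decide +kernel) (by decide +kernel)
    5 (by norm_num) (by norm_num) (by norm_num) (by decide +kernel) (n := 8) (by decide +kernel)
    (by decide) 191 (by norm_num) (by norm_num) (by decide +kernel) (by decide +kernel) (e := 1)
    (by decide +kernel) (by decide +kernel) (by norm_num) hJ hMcU hGZK hKo hrec hD36 hlev W hW hK hD3
    hD4 hH hP hnt hI hr hs hv

end Summit.BirchSwinnertonDyer.Rank1Residual.JET

end
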